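import Mathlib
import Literature.Analysis.ODE.LinearComparison
import Summits.NavierStokesRegularity.NavierStokesRegularity.Theorems.SubOnsagerCeilingDyadicRangeChain
import Summits.NavierStokesRegularity.NavierStokesRegularity.Theorems.SubOnsagerCeilingVirtualFloorGame
import HarnessLib

/-!
# The chain barrier FROM A CERTIFIABLE GAME HYPOTHESIS (rigid viscous damping profile), every `b ∈ (1, 2]`
(helper file for crux stmt-NavierStokesRegularity-27057 `SubOnsagerCeiling.ForwardTailCeilingKP`, `--supports … --as helper`;
LEAD SOC census v9 §G.5 / idea card `Cruxes/ForwardTailCeilingKP/Ideas/virtual-floor-game.md`)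

Sibling of `SubOnsagerCeilingVirtualFloorChain` (`chain_shellBarrier_of_game`, whose game hypothesis quantifies over
INDEPENDENT dampings `dᵢ ≥ 0` and is therefore never satisfiable — LEAD g6's own correction): here the game carries
ONE scalar damping `d ≥ 0` with the lattice's rigid viscous profile `d·(b²)ⁱ` on shell `i` of the window and
`d·(b²)^{k₀+1}` on the virtual floor, exactly what the chain `κ_{k+1} = νb^{2k}` produces; the reduction is
`VirtualFloor.gameBarrier_le_one_of_tail_geom` (p664618). For every `b ∈ (1, 2]`:

  certificate «every play of the depth-`k₀` rigid-damping virtual-floor game at `(p(b), L(b), b², 1/10)` keeps its shells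
  `< 1`» ⟹ `b^{2θk} Z_k(t)² ≤ 100·x₀²` (`θ = 101/200`) along every honest non-negative `ν`-viscous chain solution.

Measured game values (census v9 §G.5; viscosity only lowers them): depth 2 closes `b ≳ 1.35`, depth 3–4 closes `b = 5/4`.
No certificate is proved here. MODEL lattice; nothing here bears on Navier–Stokes regularity; 27057 stays OPEN.
[cite: BarbatoMorandinRomito2011, §3.2 proof of Thm. 1 (the rescaling)] [cite: Tao2016AveragedNS, §4 (4.5), (4.13)]
-/

noncomputable section

-- the sub-problem namespace `NavierStokesRegularity.NavierStokesRegularity` is the tree's layout (D-0017)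
set_option linter.dupNamespace false

namespace Summit.NavierStokesRegularity.NavierStokesRegularity.Theorems.VirtualFloor

open Set Filter Topology
open Summit.NavierStokesRegularity.NavierStokesRegularity.Theorems.DyadicRange

set_option maxHeartbeats 400000 in
/-- **The chain barrier at ANY scale ratio `b ∈ (1, 2]` FROM A CERTIFIABLE GAME HYPOTHESIS** (LEAD g6 correction of
`chain_shellBarrier_of_game`): the same conclusion from the GEOMETRIC-DAMPING game — one scalar damping `d ≥ 0` with the
lattice's rigid viscous profile `d·(b²)ⁱ` on shell `i` of the window (and `d·(b²)^{k₀+1}` on the floor) — via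
`gameBarrier_le_one_of_tail_geom`. This is the hypothesis a polynomial-barrier certificate can prove.
[cite: BarbatoMorandinRomito2011, §3.2 (the rescaling)] -/
theorem chain_shellBarrier_of_game_geom {b c₀ ν s x₀ : ℝ} {k₀ : ℕ} (hb : 1 < b) (hb2 : b ≤ 2) (hc₀ : 0 < c₀)
    (hν : 0 < ν) (hs : 0 < s) {Z : ℤ → ℝ → ℝ}
    (hGame : ∀ (Fr T : ℝ), 0 < Fr → 0 < T →
      ∀ (S : ℕ → ℝ → ℝ) (d : ℝ) (v y : ℝ → ℝ),
      (∀ i, i ≤ k₀ → ContinuousOn (S i) (Icc 0 T)) → ContinuousOn y (Icc 0 T) →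
      (∀ i, i ≤ k₀ → ∀ t ∈ Ico 0 T, HasDerivWithinAt (S i)
        (-(d * (b ^ 2) ^ i) * S i t + Fr * (b ^ ((5 : ℝ) / 2) / b ^ ((101 : ℝ) / 200)) ^ i *
          ((if i = 0 then v t else S (i - 1) t) ^ 2 -
          b ^ ((5 : ℝ) / 2) / (b ^ ((101 : ℝ) / 200)) ^ 3 * S i t * (if i = k₀ then y t else S (i + 1) t)))
          (Ici t) t) →
      (∀ t ∈ Ico 0 T, ∃ y' : ℝ, HasDerivWithinAt y y' (Ici t) t ∧
        -(d * (b ^ 2) ^ (k₀ + 1)) * y t + Fr * (b ^ ((5 : ℝ) / 2) / b ^ ((101 : ℝ) / 200)) ^ (k₀ + 1) *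
          (S k₀ t ^ 2 - b ^ ((5 : ℝ) / 2) / (b ^ ((101 : ℝ) / 200)) ^ 3 * y t) ≤ y') →
      0 ≤ d →
      (∀ t ∈ Icc 0 T, 0 ≤ v t ∧ v t ≤ 1) → (∀ t ∈ Icc 0 T, 0 ≤ y t ∧ y t ≤ 1) →
      (∀ i, i ≤ k₀ → ∀ t ∈ Icc 0 T, 0 ≤ S i t) → (∀ i, i ≤ k₀ → S i 0 ≤ 1 / 10) →
      ∀ i, i ≤ k₀ → ∀ t ∈ Icc 0 T, S i t < 1)
    (hdat : ∀ k : ℤ, Z k 0 = if k = 0 then x₀ else 0)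
    (hvan : ∀ t, Z (-1) t = 0)
    (hbdd : ∃ M : ℝ, ∀ (t : ℝ) (k : ℕ), (1 + b ^ ((10 : ℝ) * k)) * |Z k t| ≤ M)
    (hcont : ∀ k : ℕ, ContinuousOn (Z k) (Icc 0 s))
    (hode : ∀ k : ℕ, ∀ t ∈ Icc 0 s, HasDerivWithinAt (Z k)
      (c₀ * (b ^ ((5 : ℝ) * ((k : ℝ) - 1) / 2) * Z ((k : ℤ) - 1) t ^ 2 -
          b ^ ((5 : ℝ) * (k : ℝ) / 2) * (Z k t * Z ((k : ℤ) + 1) t)) -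
        ν * b ^ ((2 : ℝ) * (k : ℝ)) * Z k t) (Icc 0 s) t)
    (hnn : ∀ t ∈ Icc 0 s, ∀ k : ℕ, 1 ≤ k → 0 ≤ Z k t) :
    ∀ t ∈ Icc 0 s, ∀ k : ℕ, (b ^ ((101 : ℝ) / 200)) ^ (2 * k) * Z k t ^ 2 ≤ 100 * x₀ ^ 2 := by
  intro t ht k
  have hb0 : 0 < b := by linarith
  have hb1 : 1 ≤ b := hb.le
  -- the constants
  set B₁ : ℝ := b ^ ((101 : ℝ) / 200) with hB₁
  set B₅ : ℝ := b ^ ((5 : ℝ) / 2) with hB₅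
  have hB₁0 : 0 < B₁ := Real.rpow_pos_of_pos hb0 _
  have hB₅0 : 0 < B₅ := Real.rpow_pos_of_pos hb0 _
  set L : ℝ := B₅ / B₁ with hL
  set p : ℝ := B₅ / B₁ ^ 3 with hp
  have hL0 : 0 < L := div_pos hB₅0 hB₁0
  have hp0 : 0 < p := div_pos hB₅0 (pow_pos hB₁0 3)
  -- powers of `b` along the shells
  have hΛ : ∀ k : ℕ, b ^ ((5 : ℝ) * (k : ℝ) / 2) = B₅ ^ k := by
    intro k
    rw [hB₅, ← Real.rpow_mul_natCast hb0.le]; congr 1; ring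
  have hΛ' : ∀ k : ℕ, b ^ ((5 : ℝ) * ((k : ℝ) - 1) / 2) = B₅ ^ k / B₅ := by
    intro k
    rw [show (5 : ℝ) * ((k : ℝ) - 1) / 2 = (5 : ℝ) * (k : ℝ) / 2 - 5 / 2 by ring, Real.rpow_sub hb0,
      hΛ k]
  have h2k : ∀ k : ℕ, b ^ ((2 : ℝ) * (k : ℝ)) = (b ^ 2) ^ k := by
    intro k
    rw [Real.rpow_mul_natCast hb0.le, Real.rpow_two]
  -- the sign of the datum shell
  set σ : ℝ := if 0 ≤ x₀ then 1 else -1 with hσ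
  have hσ2 : σ ^ 2 = 1 := by rw [hσ]; split_ifs <;> norm_num
  have hσa : σ * x₀ = |x₀| := by
    rw [hσ]; split_ifs with h
    · rw [abs_of_nonneg h, one_mul]
    · rw [abs_of_neg (not_le.1 h)]; ring
  -- the datum shell keeps its sign on `[0, s]`: `g = σ Z₀` solves `ġ = -(c₀ Z₁ + ν) g`
  have hg_nonneg : ∀ τ ∈ Icc 0 s, 0 ≤ σ * Z 0 τ := by
    have hode0 : ∀ r ∈ Ico 0 s, HasDerivWithinAt (fun r => σ * Z 0 r)
        (0 + (-(c₀ * Z 1 r + ν)) * (σ * Z 0 r)) (Ici r) r := by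
      intro r hr
      have h := hode 0 r (Ico_subset_Icc_self hr)
      have e1 : ((0 : ℕ) : ℤ) - 1 = -1 := by norm_num
      have e2 : ((0 : ℕ) : ℤ) + 1 = 1 := by norm_num
      rw [e1, e2, hvan r] at h
      have h' := (h.mono_of_mem_nhdsWithin (Icc_mem_nhdsGE_of_mem hr)).const_mul σ
      refine h'.congr_deriv ?_
      have e3 : b ^ ((5 : ℝ) * ((0 : ℕ) : ℝ) / 2) = 1 := by simp
      have e4 : b ^ ((2 : ℝ) * ((0 : ℕ) : ℝ)) = 1 := by simp
      rw [e3, e4]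
      ring
    have hcg : ContinuousOn (fun r => σ * Z 0 r) (Icc 0 s) := continuousOn_const.mul (hcont 0)
    have h00 : 0 ≤ σ * Z 0 0 := by rw [hdat 0, if_pos rfl, hσa]; exact abs_nonneg _
    exact datum_sign_nonneg hcg (hcont 1) hode0 h00
  -- the weight bound
  obtain ⟨M, hM⟩ := hbdd
  have hM0 : 0 ≤ M := le_trans (mul_nonneg (by positivity) (abs_nonneg _)) (hM 0 0)
  -- the bound for every `η > 0`
  suffices main : ∀ η : ℝ, 0 < η → B₁ ^ (2 * k) * Z k t ^ 2 ≤ 100 * (|x₀| + η) ^ 2 by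
    clear hGame
    have hc : Continuous (fun η : ℝ => 100 * (|x₀| + η) ^ 2) :=
      continuous_const.mul ((continuous_const.add continuous_id).pow 2)
    have hlim : Tendsto (fun η : ℝ => 100 * (|x₀| + η) ^ 2) (𝓝[>] 0) (𝓝 (100 * (|x₀| + 0) ^ 2)) :=
      tendsto_nhdsWithin_of_tendsto_nhds (hc.tendsto 0)
    rw [add_zero, sq_abs] at hlim
    exact ge_of_tendsto hlim (eventually_nhdsWithin_of_forall fun η hη => main η hη)
  intro η hη
  have hxη : 0 < |x₀| + η := by positivity
  set A : ℝ := 1 / 10 / (|x₀| + η) with hA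
  have hA0 : 0 < A := by positivity
  -- the rescaled chain
  set sg : ℕ → ℝ := fun k => if k = 0 then σ else 1 with hsg
  have hsg2 : ∀ k, sg k ^ 2 = 1 := by intro k; rw [hsg]; dsimp only; split_ifs; exact hσ2; norm_num
  set Y : ℕ → ℝ → ℝ := fun n τ =>
    if n = 0 then 0 else A * B₁ ^ (n - 1) * (sg (n - 1) * Z ((n - 1 : ℕ) : ℤ) τ) with hY
  have hY0 : ∀ τ, Y 0 τ = 0 := fun τ => by simp [hY]
  have hYs : ∀ (k : ℕ) (τ : ℝ), Y (k + 1) τ = A * B₁ ^ k * (sg k * Z k τ) := by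
    intro k τ; simp [hY]
  have hY1 : ∀ τ, Y 1 τ = A * (σ * Z 0 τ) := fun τ => by
    rw [show (1 : ℕ) = 0 + 1 from rfl, hYs]; simp [hsg]
  have hY2 : ∀ (j : ℕ) (τ : ℝ), Y (j + 2) τ = A * B₁ ^ (j + 1) * Z ((j + 1 : ℕ) : ℤ) τ := by
    intro j τ; rw [show j + 2 = (j + 1) + 1 from rfl, hYs]; simp [hsg]
  set b2 : ℝ := b ^ 2 with hb2def
  have hb20 : 0 < b2 := by rw [hb2def]; positivity
  have hb21 : 1 ≤ b2 := by rw [hb2def]; exact one_le_pow₀ hb1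
  have hb24 : b2 ≤ 4 := by rw [hb2def]; nlinarith
  set G : ℝ := c₀ / A * (B₁ ^ 2 / B₅) with hG
  have hG0 : 0 < G := by rw [hG]; positivity
  set κ : ℕ → ℝ := fun n => ν * b2 ^ n / b2 with hκ
  set F : ℕ → ℝ := fun n => G * L ^ n / L with hF
  obtain ⟨hκpos, hκmono, hκ4, hκs0⟩ :
      (∀ n, 0 < κ n) ∧ (∀ n, κ n ≤ κ (n + 1)) ∧ (∀ n, κ (n + 1) ≤ 4 * κ n) ∧
        (∀ k : ℕ, κ (k + 1) = ν * b2 ^ k) := kappa_facts hν hb20 hb21 hb24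
  obtain ⟨hFpos, hFL, hFs0⟩ :
      (∀ n, 0 < F n) ∧ (∀ n, F (n + 1) = L * F n) ∧ (∀ k : ℕ, F (k + 1) = G * L ^ k) :=
    prod_facts hG0 hL0
  have hκs : ∀ k : ℕ, κ (k + 1) = ν * b2 ^ k := hκs0
  have hFs : ∀ k : ℕ, F (k + 1) = G * L ^ k := hFs0
  -- continuity, positivity, datum
  have hYcont : ∀ n, ContinuousOn (Y n) (Icc 0 s) := by
    intro n
    rcases n with _ | k
    · have : Y 0 = fun _ => 0 := funext hY0
      rw [this]; exact continuousOn_const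
    · have : Y (k + 1) = fun τ => A * B₁ ^ k * (sg k * Z k τ) := funext (hYs k)
      rw [this]
      exact continuousOn_const.mul (continuousOn_const.mul (hcont k))
  have hYpos : ∀ n, ∀ τ ∈ Icc 0 s, 0 ≤ Y n τ := by
    intro n τ hτ
    rcases n with _ | k
    · rw [hY0]
    rcases k with _ | j
    · rw [hY1]; exact mul_nonneg hA0.le (hg_nonneg τ hτ)
    · rw [hY2]; exact mul_nonneg (by positivity) (hnn τ hτ (j + 1) (by omega))
  have hYinit : ∀ n, Y n 0 ≤ 1 / 10 := by
    intro n
    rcases n with _ | k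
    · rw [hY0]; norm_num
    rcases k with _ | j
    · have hAx : A * |x₀| ≤ 1 / 10 := by
        rw [hA, div_mul_eq_mul_div, div_le_iff₀ hxη]
        linarith [abs_nonneg x₀]
      rw [hY1, hdat 0, if_pos rfl, hσa]; exact hAx
    · have hne : (((j + 1 : ℕ) : ℤ)) ≠ 0 := Int.natCast_ne_zero.mpr (Nat.succ_ne_zero j)
      rw [hY2, hdat, if_neg hne, mul_zero]; norm_num
  -- the quiescent tail (Tao's weight bound (4.5))
  have hbt : 0 < b ^ (10 : ℝ) := Real.rpow_pos_of_pos hb0 _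
  set q : ℝ := B₁ / b ^ (10 : ℝ) with hq
  have hq0 : 0 ≤ q := by rw [hq]; positivity
  have hq1 : q < 1 := by
    rw [hq, div_lt_one hbt, hB₁]
    exact Real.rpow_lt_rpow_of_exponent_lt (by linarith) (by norm_num)
  have hZle : ∀ (k : ℕ) (τ : ℝ), (b ^ (10 : ℝ)) ^ k * |Z k τ| ≤ M := by
    intro k τ
    have h := hM τ k
    rw [Real.rpow_mul_natCast hb0.le] at h
    have h0 : 0 ≤ |Z k τ| := abs_nonneg _
    have h1 : (1 + (b ^ (10 : ℝ)) ^ k) * |Z k τ| = |Z k τ| + (b ^ (10 : ℝ)) ^ k * |Z k τ| := by ring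
    linarith
  have hYle' : ∀ (k : ℕ) (τ : ℝ), Y (k + 1) τ ≤ A * M * q ^ k := by
    intro k τ
    rw [hYs]
    have hs : |sg k| = 1 := by
      rw [hsg]; dsimp only; split_ifs
      · rw [hσ]; split_ifs <;> norm_num
      · norm_num
    have h1 : sg k * Z k τ ≤ |Z k τ| := by
      have := le_abs_self (sg k * Z k τ)
      rwa [abs_mul, hs, one_mul] at this
    have h2 : B₁ ^ k * |Z k τ| = q ^ k * ((b ^ (10 : ℝ)) ^ k * |Z k τ|) := by
      rw [hq, div_pow]; field_simp
    have h3 : q ^ k * ((b ^ (10 : ℝ)) ^ k * |Z k τ|) ≤ q ^ k * M :=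
      mul_le_mul_of_nonneg_left (hZle k τ) (pow_nonneg hq0 k)
    calc A * B₁ ^ k * (sg k * Z k τ) ≤ A * B₁ ^ k * |Z k τ| :=
          mul_le_mul_of_nonneg_left h1 (by positivity)
      _ = A * (B₁ ^ k * |Z k τ|) := by ring
      _ = A * (q ^ k * ((b ^ (10 : ℝ)) ^ k * |Z k τ|)) := by rw [h2]
      _ ≤ A * (q ^ k * M) := mul_le_mul_of_nonneg_left h3 hA0.le
      _ = A * M * q ^ k := by ring
  obtain ⟨K, hK⟩ := geometric_tail_small hq0 hq1 (show 0 ≤ A * M by positivity)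
  have hYtail : ∀ n, K + 1 ≤ n → ∀ τ ∈ Icc 0 s, Y n τ ≤ 1 / 10 := by
    intro n hn τ _
    obtain ⟨k, rfl⟩ : ∃ k, n = k + 1 := ⟨n - 1, by omega⟩
    exact (hYle' k τ).trans (hK k (by omega))
  -- the equations of motion of the rescaled chain
  have hYderiv : ∀ n, 1 ≤ n → ∀ τ ∈ Ico 0 s, HasDerivWithinAt (Y n)
      (-κ n * Y n τ + F n * (Y (n - 1) τ ^ 2 - p * Y n τ * Y (n + 1) τ)) (Ici τ) τ := by
    intro n hn τ hτ
    obtain ⟨k, rfl⟩ : ∃ k, n = k + 1 := ⟨n - 1, by omega⟩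
    have h := hode k τ (Ico_subset_Icc_self hτ)
    rw [hΛ' k, hΛ k, h2k k] at h
    have h' := (h.mono_of_mem_nhdsWithin (Icc_mem_nhdsGE_of_mem hτ)).const_mul (A * B₁ ^ k * sg k)
    have hfun : Y (k + 1) = fun r => A * B₁ ^ k * sg k * Z k r := by
      funext r; rw [hYs]; ring
    rw [hfun]
    refine h'.congr_deriv ?_
    simp only [Nat.add_sub_cancel]
    rw [hκs k, hFs k, show k + 1 + 1 = k + 2 from rfl, hY2 k]
    have ek : ((k : ℕ) : ℤ) + 1 = (((k + 1 : ℕ)) : ℤ) := by push_cast; ring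
    rw [ek]
    rcases k with _ | j
    · -- the datum shell: no feed (`Z_{-1} = 0`, `Y_0 = 0`)
      have e1 : ((0 : ℕ) : ℤ) - 1 = -1 := by norm_num
      rw [e1, hvan τ, hY0, hG, hL, hp]
      linear_combination rescale_identity_zero A B₁ B₅ c₀ ν (sg 0) (Z 0 τ) (Z ((0 + 1 : ℕ) : ℤ) τ)
        hA0.ne' hB₁0.ne' hB₅0.ne'
    · have e1 : (((j + 1 : ℕ)) : ℤ) - 1 = ((j : ℕ) : ℤ) := by push_cast; ring
      have es1 : sg (j + 1) = 1 := by simp [hsg]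
      rw [e1, hYs j, es1, hG, hL, hp]
      linear_combination rescale_identity_succ A B₁ B₅ c₀ ν b2 (sg j) (Z j τ)
        (Z ((j + 1 : ℕ) : ℤ) τ) (Z ((j + 1 + 1 : ℕ) : ℤ) τ) j hA0.ne' hB₁0.ne' hB₅0.ne' (hsg2 j)
  -- the game reduction: `Y ≤ 1`
  have hYle : ∀ n, ∀ τ ∈ Icc 0 s, Y n τ ≤ 1 :=
    gameBarrier_le_one_of_tail_geom (K := K + 1) (k := k₀) (b2 := b2) hs (fun n => (hκpos n).le)
      (fun n => by simp only [hκ]; rw [pow_succ]; field_simp) hFpos hFL hp0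
      (by norm_num : (1 / 10 : ℝ) < 1) (by simpa only [hb2def] using hGame) hY0 hYcont hYderiv hYpos hYinit hYtail
  -- conclusion at the shell `k`
  exact unscale_bound hxη hA (hYs k t) (hsg2 k) (hYpos (k + 1) t ht) (hYle (k + 1) t ht)




end Summit.NavierStokesRegularity.NavierStokesRegularity.Theorems.VirtualFloor

end
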